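import Summits.NavierStokesRegularity.NavierStokesRegularity.Theses.AdaptedFrequency
import Summits.NavierStokesRegularity.NavierStokesRegularity.Theorems.AdaptedFrequencyAdaptedFrequencyConvergesStubPinchedHullRecurrenceOrbit
import Literature.Analysis.FluidPDE.AdaptedBackwardKernel
import Literature.Analysis.FluidPDE.TypeIAncientMild
import Literature.Analysis.FluidPDE.SelfSimilar
import Literature.Dynamics.TopologicalDynamics.UniformRecurrence
import Literature.Dynamics.TopologicalDynamics.MinimalOrbitClosure
import Mathlib.Topology.ContinuousMap.Compact
import Mathlib.Topology.Metrizable.Basic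
import HarnessLib

/-!
# Crux `AdaptedFrequencyConverges` (stmt-NavierStokesRegularity-10493), line `birkhoff-recurrent-hull`:
  stub `stub_pinchedHullRecurrence` — Birkhoff recurrence on the pinched hull

Proof file (`--supports` the crux item; stub-worker of lead prover-line-stmt-NavierStokesRegularity-10493-c4-0)
of the registered stub `stub_pinchedHullRecurrence` of the skeleton
`Cruxes/AdaptedFrequencyConverges/Lines/birkhoff_recurrent_hull.lean`: if some pinched unit-viscosity
Type-I ancient mild pair exists, then a UNIFORMLY RECURRENT one exists (recurrence of the PAIR under
the parabolic scaling, uniformly on the compact cylinders `[−R, −1/R] × B̄(0, R)`).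

Proof (Birkhoff–Furstenberg on the pinched hull, mirroring the tree's `recurrentReduction_proof`):

* MODEL.  Fix the constants `(C₀, c, C')` of the given pair and the four Gaussian constants of its
  kernel.  `X` = pinched PAIRS `(W, K)` with these constants (part 2, `pinchedPair_nsRescale`:
  invariant under `(W, K) ↦ (W_l, K_l)`), with the initial topology of the restrictions of BOTH
  components to the slab pieces `[−(n+2), −1/(n+2)] × B̄(0, n+2)`, valued in the metric spaces
  `C(piece, ℝ³) × C(piece, ℝ)` — pseudo-metrisable (countable product), and convergence in `X` is
  uniform convergence of both components on every piece.  The scaling flow `ϕ σ (W, K) =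
  (W_{e^σ}, K_{e^σ})` acts on `X` with the action law and continuously (a dilated piece lies in a
  larger piece).
* ORBIT CLOSURE.  `S` = closure of the orbit of the given pair; invariant (`mapsTo_closure_orbit`)
  and compact: sequentially compact by part 2 (`pinchedPair_orbitLimit`: every sequence of orbit
  points subconverges in `X` to a pinched pair — KNSS `C²_loc` compactness, kernel stability,
  pinching in the limit, and the equicontinuity upgrade of part 1), in a pseudo-metrisable space.
* BIRKHOFF.  `S` carries a uniformly recurrent point (`exists_isUniformlyRecurrentPt`, Furstenberg
  1981 Thm. 1.16); unwinding uniform recurrence on the sup-ball of a piece containing the cylinder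
  (`isSyndetic_iff_exists_window`, `σ = log l`) is the displayed clause, and the kernel of the
  recurrent pair is unique by kernel uniqueness for Type-I drifts (`pinchedPair_kernel_unique`).
-/

noncomputable section

-- the summit and its single problem share the name (D-0017 nested layout)
set_option linter.dupNamespace false

namespace Summit.NavierStokesRegularity.NavierStokesRegularity.Theorems.AdaptedFrequencyConverges.BirkhoffRecurrentHull

open scoped Topology
open Literature.Analysis.FluidPDE Set Filter MeasureTheory Function Metric TopologicalSpace Topology
open Literature.Dynamics.TopologicalDynamics

/-- For `l > 0` the parabolic dilation `(t, x) ↦ (l²t, l x)` maps each slab piece into a larger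
one. [folklore] -/
theorem exists_slabPiece_mapsTo_dilate {l : ℝ} (hl : 0 < l) (n : ℕ) :
    ∃ m : ℕ, ∀ z ∈ Icc (-((n : ℝ) + 2)) (-(1 / ((n : ℝ) + 2))) ×ˢ
        closedBall (0 : EuclideanSpace ℝ (Fin 3)) ((n : ℝ) + 2),
      ((l ^ 2 * z.1, l • z.2) : ℝ × EuclideanSpace ℝ (Fin 3)) ∈
        Icc (-((m : ℝ) + 2)) (-(1 / ((m : ℝ) + 2))) ×ˢ
          closedBall (0 : EuclideanSpace ℝ (Fin 3)) ((m : ℝ) + 2) := by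
  set N : ℝ := (n : ℝ) + 2 with hN
  have hN0 : 0 < N := by positivity
  have hl2 : 0 < l ^ 2 := by positivity
  have hli : 0 < (l ^ 2)⁻¹ := inv_pos.2 hl2
  obtain ⟨m, hm⟩ := exists_nat_ge ((l ^ 2 + (l ^ 2)⁻¹ + l) * N)
  have hM0 : (0 : ℝ) < (m : ℝ) + 2 := by positivity
  have hM : (l ^ 2 + (l ^ 2)⁻¹ + l) * N ≤ (m : ℝ) + 2 := hm.trans (by linarith)
  have hA : l ^ 2 * N ≤ (m : ℝ) + 2 := le_trans (by nlinarith) hM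
  have hB : (l ^ 2)⁻¹ * N ≤ (m : ℝ) + 2 := le_trans (by nlinarith) hM
  have hC : l * N ≤ (m : ℝ) + 2 := le_trans (by nlinarith) hM
  refine ⟨m, fun z hz => ?_⟩
  obtain ⟨⟨h1, h2⟩, h3⟩ := mem_slabPiece.1 hz
  refine mem_slabPiece.2 ⟨⟨by nlinarith, ?_⟩, ?_⟩
  · have key : 1 / ((m : ℝ) + 2) ≤ l ^ 2 * (1 / N) := by
      rw [div_le_iff₀ hM0]
      calc (1 : ℝ) = l ^ 2 * (1 / N) * ((l ^ 2)⁻¹ * N) := by field_simp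
        _ ≤ l ^ 2 * (1 / N) * ((m : ℝ) + 2) := mul_le_mul_of_nonneg_left hB (by positivity)
    have : l ^ 2 * z.1 ≤ l ^ 2 * (-(1 / N)) := mul_le_mul_of_nonneg_left h2 hl2.le
    show l ^ 2 * z.1 ≤ -(1 / ((m : ℝ) + 2))
    linarith
  · show ‖l • z.2‖ ≤ (m : ℝ) + 2
    rw [norm_smul, Real.norm_of_nonneg hl.le]
    nlinarith

/-- **Stub 1 — Birkhoff recurrence on the pinched hull.** If some pinched unit-viscosity Type-I
ancient mild pair exists, a UNIFORMLY RECURRENT one exists (module docstring: Birkhoff–Furstenberg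
minimal-set argument on the compact pseudo-metrisable orbit closure of the given pair in the
topology of uniform convergence of both components on the slab pieces; compactness by
`pinchedPair_orbitLimit`, invariance by `pinchedPair_nsRescale`, recurrence by
`exists_isUniformlyRecurrentPt`, kernel uniqueness by `pinchedPair_kernel_unique`).
[cite: Furstenberg1981, Ch. 1 §4, Thm. 1.16; KochNadirashviliSereginSverak2009, Prop. 4.1 (arXiv:0709.3599 p. 8)] -/
theorem stub_pinchedHullRecurrence :
    (∃ (C₀ c C' : ℝ) (W : ℝ → EuclideanSpace ℝ (Fin 3) → EuclideanSpace ℝ (Fin 3))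
        (K : ℝ → EuclideanSpace ℝ (Fin 3) → ℝ),
      0 ≤ C₀ ∧ 0 < c ∧ IsTypeIAncientMild C₀ W ∧ IsAdaptedBackwardKernel 1 W (Iio 0) 0 0 K ∧
        IsGaussianComparable K (Iio 0) 0 0 ∧
        (∀ K' : ℝ → EuclideanSpace ℝ (Fin 3) → ℝ, IsAdaptedBackwardKernel 1 W (Iio 0) 0 0 K' →
          IsGaussianComparable K' (Iio 0) 0 0 → ∀ t ∈ Iio (0:ℝ), K' t = K t) ∧
        (∀ τ ∈ Iio (0:ℝ), c ≤ (-τ) ^ 2 * adaptedEnstrophy W K τ ∧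
          (-τ) ^ 2 * adaptedEnstrophy W K τ ≤ C')) →
    ∃ (C₀ c C' : ℝ) (W : ℝ → EuclideanSpace ℝ (Fin 3) → EuclideanSpace ℝ (Fin 3))
        (K : ℝ → EuclideanSpace ℝ (Fin 3) → ℝ),
      (0 ≤ C₀ ∧ 0 < c ∧ IsTypeIAncientMild C₀ W ∧ IsAdaptedBackwardKernel 1 W (Iio 0) 0 0 K ∧
        IsGaussianComparable K (Iio 0) 0 0 ∧
        (∀ K' : ℝ → EuclideanSpace ℝ (Fin 3) → ℝ, IsAdaptedBackwardKernel 1 W (Iio 0) 0 0 K' →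
          IsGaussianComparable K' (Iio 0) 0 0 → ∀ t ∈ Iio (0:ℝ), K' t = K t) ∧
        (∀ τ ∈ Iio (0:ℝ), c ≤ (-τ) ^ 2 * adaptedEnstrophy W K τ ∧
          (-τ) ^ 2 * adaptedEnstrophy W K τ ≤ C')) ∧
      (∀ ε : ℝ, 0 < ε → ∀ R : ℝ, 1 < R → ∃ L : ℝ, 1 < L ∧ ∀ a : ℝ, 0 < a → ∃ l : ℝ, a ≤ l ∧ l ≤ L * a ∧
        ∀ (t : ℝ) (x : EuclideanSpace ℝ (Fin 3)), -R ≤ t → t ≤ -R⁻¹ → ‖x‖ ≤ R →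
          ‖nsRescale l W t x - W t x‖ ≤ ε ∧ |l ^ 3 * K (l ^ 2 * t) (l • x) - K t x| ≤ ε) := by
  classical
  rintro ⟨C₀, c, C', W₀, K₀, hC₀, hc, hW₀, hK₀, hcmp₀, -, hpin₀⟩
  obtain ⟨c₁, c₂, C₁, C₂, hc₁, hc₂, hC₁, hC₂, hKb₀⟩ := isGaussianComparable_iff_fin_three.1 hcmp₀
  -- ## the hull: pinched pairs with the constants of the given pair
  set P : (ℝ → EuclideanSpace ℝ (Fin 3) → EuclideanSpace ℝ (Fin 3)) × (ℝ → EuclideanSpace ℝ (Fin 3) → ℝ) →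
      Prop := fun p =>
    IsTypeIAncientMild C₀ p.1 ∧ IsAdaptedBackwardKernel 1 p.1 (Iio 0) 0 0 p.2 ∧
      (∀ t ∈ Iio (0:ℝ), ∀ x,
        c₁ * ((0:ℝ) - t) ^ (-(3:ℝ) / 2) *
            Real.exp (-(‖x - (0 : EuclideanSpace ℝ (Fin 3))‖ ^ 2) / (c₂ * ((0:ℝ) - t))) ≤ p.2 t x ∧
          p.2 t x ≤ C₁ * ((0:ℝ) - t) ^ (-(3:ℝ) / 2) *
            Real.exp (-(‖x - (0 : EuclideanSpace ℝ (Fin 3))‖ ^ 2) / (C₂ * ((0:ℝ) - t)))) ∧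
      (∀ τ ∈ Iio (0:ℝ), c ≤ (-τ) ^ 2 * adaptedEnstrophy p.1 p.2 τ ∧
        (-τ) ^ 2 * adaptedEnstrophy p.1 p.2 τ ≤ C') with hP
  have hPz : ∀ p, P p → ∀ l : ℝ, 0 < l →
      P (nsRescale l p.1, fun t x => l ^ 3 * p.2 (l ^ 2 * t) (l • x)) := by
    rintro p ⟨h1, h2, h3, h4⟩ l hl
    exact pinchedPair_nsRescale h1 h2 h3 h4 hl
  let X := {p : (ℝ → EuclideanSpace ℝ (Fin 3) → EuclideanSpace ℝ (Fin 3)) ×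
    (ℝ → EuclideanSpace ℝ (Fin 3) → ℝ) // P p}
  -- the slab pieces
  set T : ℕ → Set (ℝ × EuclideanSpace ℝ (Fin 3)) := fun n =>
    Icc (-((n : ℝ) + 2)) (-(1 / ((n : ℝ) + 2))) ×ˢ closedBall (0 : EuclideanSpace ℝ (Fin 3)) ((n : ℝ) + 2)
    with hT
  haveI hTc : ∀ n, CompactSpace (T n) := fun n => isCompact_iff_compactSpace.1 (isCompact_slabPiece n)
  have hTsub : ∀ n, T n ⊆ Iio (0:ℝ) ×ˢ (univ : Set (EuclideanSpace ℝ (Fin 3))) := fun n z hz =>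
    ⟨neg_of_mem_slabPiece hz, mem_univ _⟩
  -- ## the model map and the topology
  have hcW : ∀ (p : X) (n : ℕ), Continuous fun z : T n => p.1.1 z.1.1 z.1.2 := fun p n =>
    continuousOn_iff_continuous_restrict.1 (p.2.1.continuousOn_uncurry.mono (hTsub n))
  have hcK : ∀ (p : X) (n : ℕ), Continuous fun z : T n => p.1.2 z.1.1 z.1.2 := fun p n =>
    continuousOn_iff_continuous_restrict.1 (p.2.2.1.contDiffOn.continuousOn.mono (hTsub n))
  let Φ : X → ((n : ℕ) → C(T n, EuclideanSpace ℝ (Fin 3)) × C(T n, ℝ)) := fun p n =>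
    (⟨fun z => p.1.1 z.1.1 z.1.2, hcW p n⟩, ⟨fun z => p.1.2 z.1.1 z.1.2, hcK p n⟩)
  letI tX : TopologicalSpace X := TopologicalSpace.induced Φ inferInstance
  have hΦ : IsInducing Φ := ⟨rfl⟩
  haveI hXm : PseudoMetrizableSpace X := hΦ.pseudoMetrizableSpace
  -- convergence in `X` is uniform convergence of both components on every piece
  have htend : ∀ (x : ℕ → X) (a : X), Tendsto x atTop (𝓝 a) ↔
      (∀ n, TendstoUniformlyOn (fun j z => (x j).1.1 z.1 z.2) (fun z => a.1.1 z.1 z.2) atTop (T n)) ∧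
      (∀ n, TendstoUniformlyOn (fun j z => (x j).1.2 z.1 z.2) (fun z => a.1.2 z.1 z.2) atTop (T n)) := by
    intro x a
    rw [hΦ.tendsto_nhds_iff, tendsto_pi_nhds]
    constructor
    · intro h
      refine ⟨fun n => ?_, fun n => ?_⟩
      · have h1 := ((Prod.tendsto_iff _ _).1 (h n)).1
        rw [ContinuousMap.tendsto_iff_tendstoUniformly] at h1
        rw [tendstoUniformlyOn_iff_tendstoUniformly_comp_coe]
        exact h1
      · have h1 := ((Prod.tendsto_iff _ _).1 (h n)).2
        rw [ContinuousMap.tendsto_iff_tendstoUniformly] at h1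
        rw [tendstoUniformlyOn_iff_tendstoUniformly_comp_coe]
        exact h1
    · rintro ⟨h1, h2⟩ n
      refine (Prod.tendsto_iff _ _).2 ⟨?_, ?_⟩
      · rw [ContinuousMap.tendsto_iff_tendstoUniformly]
        have h := h1 n
        rw [tendstoUniformlyOn_iff_tendstoUniformly_comp_coe] at h
        exact h
      · rw [ContinuousMap.tendsto_iff_tendstoUniformly]
        have h := h2 n
        rw [tendstoUniformlyOn_iff_tendstoUniformly_comp_coe] at h
        exact h
  -- ## the scaling flow on `X`
  let ϕ : ℝ → X → X := fun σ p =>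
    ⟨(nsRescale (Real.exp σ) p.1.1,
      fun t x => Real.exp σ ^ 3 * p.1.2 (Real.exp σ ^ 2 * t) (Real.exp σ • x)),
      hPz p.1 p.2 (Real.exp σ) (Real.exp_pos σ)⟩
  have hadd : ∀ s t (p : X), ϕ (s + t) p = ϕ s (ϕ t p) := by
    intro s t p
    apply Subtype.ext
    apply Prod.ext
    · show nsRescale (Real.exp (s + t)) p.1.1 =
        nsRescale (Real.exp s) (nsRescale (Real.exp t) p.1.1)
      rw [Real.exp_add, mul_comm, nsRescale_mul]
    · funext t' x
      show Real.exp (s + t) ^ 3 * p.1.2 (Real.exp (s + t) ^ 2 * t') (Real.exp (s + t) • x) =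
        Real.exp s ^ 3 * (Real.exp t ^ 3 *
          p.1.2 (Real.exp t ^ 2 * (Real.exp s ^ 2 * t')) (Real.exp t • Real.exp s • x))
      have e1 : (Real.exp s * Real.exp t) ^ 2 * t' = Real.exp t ^ 2 * (Real.exp s ^ 2 * t') := by
        ring
      have e2 : (Real.exp s * Real.exp t) • x = Real.exp t • Real.exp s • x := by
        rw [smul_smul, mul_comm]
      rw [Real.exp_add, e1, e2]
      ring
  have hcont : ∀ σ, Continuous (ϕ σ) := by
    intro σ
    refine continuous_iff_seqContinuous.2 fun x a hxa => ?_
    rw [htend] at hxa ⊢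
    obtain ⟨hxW, hxK⟩ := hxa
    have hl0 : 0 < Real.exp σ := Real.exp_pos σ
    refine ⟨fun n => ?_, fun n => ?_⟩
    · obtain ⟨m, hm⟩ := exists_slabPiece_mapsTo_dilate hl0 n
      rw [Metric.tendstoUniformlyOn_iff]
      intro ε hε
      filter_upwards [Metric.tendstoUniformlyOn_iff.1 (hxW m) (ε / Real.exp σ) (div_pos hε hl0)]
        with j hj z hz
      have h := hj (Real.exp σ ^ 2 * z.1, Real.exp σ • z.2) (hm z hz)
      show dist (nsRescale (Real.exp σ) a.1.1 z.1 z.2) (nsRescale (Real.exp σ) (x j).1.1 z.1 z.2) < ε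
      rw [nsRescale_apply, nsRescale_apply, dist_smul₀, Real.norm_of_nonneg hl0.le]
      calc Real.exp σ * dist (a.1.1 (Real.exp σ ^ 2 * z.1) (Real.exp σ • z.2))
            ((x j).1.1 (Real.exp σ ^ 2 * z.1) (Real.exp σ • z.2))
          < Real.exp σ * (ε / Real.exp σ) := mul_lt_mul_of_pos_left h hl0
        _ = ε := mul_div_cancel₀ _ hl0.ne'
    · obtain ⟨m, hm⟩ := exists_slabPiece_mapsTo_dilate hl0 n
      have hl3 : 0 < Real.exp σ ^ 3 := by positivity
      rw [Metric.tendstoUniformlyOn_iff]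
      intro ε hε
      filter_upwards [Metric.tendstoUniformlyOn_iff.1 (hxK m) (ε / Real.exp σ ^ 3) (div_pos hε hl3)]
        with j hj z hz
      have h := hj (Real.exp σ ^ 2 * z.1, Real.exp σ • z.2) (hm z hz)
      show dist (Real.exp σ ^ 3 * a.1.2 (Real.exp σ ^ 2 * z.1) (Real.exp σ • z.2))
        (Real.exp σ ^ 3 * (x j).1.2 (Real.exp σ ^ 2 * z.1) (Real.exp σ • z.2)) < ε
      rw [Real.dist_eq] at h ⊢
      rw [← mul_sub, abs_mul, abs_of_pos hl3]
      calc Real.exp σ ^ 3 * |a.1.2 (Real.exp σ ^ 2 * z.1) (Real.exp σ • z.2) -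
            (x j).1.2 (Real.exp σ ^ 2 * z.1) (Real.exp σ • z.2)|
          < Real.exp σ ^ 3 * (ε / Real.exp σ ^ 3) := mul_lt_mul_of_pos_left h hl3
        _ = ε := mul_div_cancel₀ _ hl3.ne'
  -- ## the base point and its orbit closure
  let x₀ : X := ⟨(W₀, K₀), hW₀, hK₀, hKb₀, hpin₀⟩
  set S : Set X := closure (range fun σ => ϕ σ x₀) with hS
  have hSinv : ∀ t, MapsTo (ϕ t) S S := fun t => mapsTo_closure_orbit hcont hadd t x₀
  have hSne : S.Nonempty := ⟨ϕ 0 x₀, subset_closure ⟨0, rfl⟩⟩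
  -- ## KEY: subsequential limits of orbit sequences (part 2)
  have hkey : ∀ σs : ℕ → ℝ, ∃ (b : X) (ψ : ℕ → ℕ), StrictMono ψ ∧
      Tendsto (fun j => ϕ (σs (ψ j)) x₀) atTop (𝓝 b) := by
    intro σs
    obtain ⟨ψ, hψ, W', K', hW', hK', hK'b, hpin', hWu, hKu⟩ :=
      pinchedPair_orbitLimit hC₀ hc₁ hc₂ hC₁ hC₂ hW₀ hK₀ hKb₀ hpin₀ (fun k => Real.exp (σs k))
        (fun k => Real.exp_pos _)
    refine ⟨⟨(W', K'), hW', hK', hK'b, hpin'⟩, ψ, hψ, ?_⟩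
    rw [htend]
    exact ⟨hWu, hKu⟩
  -- ## compactness of the orbit closure (sequential compactness in a pseudo-metrisable space)
  have hScpt : IsCompact S := by
    letI mX : PseudoMetricSpace X := TopologicalSpace.pseudoMetrizableSpacePseudoMetric X
    refine IsSeqCompact.isCompact fun x hx => ?_
    have hnear : ∀ k : ℕ, ∃ σ : ℝ, dist (x k) (ϕ σ x₀) < 1 / ((k : ℝ) + 1) := by
      intro k
      have hk : (0 : ℝ) < 1 / ((k : ℝ) + 1) := by positivity
      obtain ⟨b, hb, hd⟩ := Metric.mem_closure_iff.1 (hx k) (1 / ((k : ℝ) + 1)) hk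
      obtain ⟨σ, rfl⟩ := hb
      exact ⟨σ, hd⟩
    choose σs hσs using hnear
    obtain ⟨a, ψ, hψ, ha⟩ := hkey σs
    refine ⟨a, ?_, ψ, hψ, ?_⟩
    · exact isClosed_closure.mem_of_tendsto ha (Eventually.of_forall fun j => subset_closure ⟨_, rfl⟩)
    · refine ha.congr_dist ?_
      have h1 : Tendsto (fun j => 1 / (((ψ j : ℕ) : ℝ) + 1)) atTop (𝓝 0) :=
        (tendsto_one_div_add_atTop_nhds_zero_nat (𝕜 := ℝ)).comp hψ.tendsto_atTop
      refine squeeze_zero (fun j => dist_nonneg) (fun j => ?_) h1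
      rw [dist_comm]
      exact (hσs (ψ j)).le
  -- ## Birkhoff: a uniformly recurrent point of the orbit closure
  obtain ⟨a, -, hrec⟩ := exists_isUniformlyRecurrentPt hcont hadd hScpt hSne hSinv
  -- ## the recurrent pinched pair
  obtain ⟨haW, haK, haKb, hapin⟩ := a.2
  have hacmp : IsGaussianComparable a.1.2 (Iio 0) 0 0 :=
    isGaussianComparable_iff_fin_three.2 ⟨c₁, c₂, C₁, C₂, hc₁, hc₂, hC₁, hC₂, haKb⟩
  refine ⟨C₀, c, C', a.1.1, a.1.2,
    ⟨hC₀, hc, haW, haK, hacmp, pinchedPair_kernel_unique haW haK hacmp, hapin⟩, ?_⟩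
  -- ## unwinding uniform recurrence on the sup-ball of a piece containing the cylinder
  intro ε hε R hR
  obtain ⟨n, hn⟩ := exists_nat_ge R
  set U : Set X := {p : X | dist (Φ p n).1 (Φ a n).1 < ε ∧ dist (Φ p n).2 (Φ a n).2 < ε} with hU
  have hUn : U ∈ 𝓝 a := by
    have h1 : Continuous fun p : X => Φ p n := (continuous_apply n).comp hΦ.continuous
    have h2 : Continuous fun p : X => (Φ p n).1 := continuous_fst.comp h1
    have h3 : Continuous fun p : X => (Φ p n).2 := continuous_snd.comp h1
    have o1 : IsOpen {p : X | dist (Φ p n).1 (Φ a n).1 < ε} :=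
      isOpen_lt (h2.dist continuous_const) continuous_const
    have o2 : IsOpen {p : X | dist (Φ p n).2 (Φ a n).2 < ε} :=
      isOpen_lt (h3.dist continuous_const) continuous_const
    refine (o1.inter o2).mem_nhds ⟨?_, ?_⟩
    · show dist (Φ a n).1 (Φ a n).1 < ε
      rw [dist_self]; exact hε
    · show dist (Φ a n).2 (Φ a n).2 < ε
      rw [dist_self]; exact hε
  have hsyn := hrec U hUn
  rw [isSyndetic_iff_exists_window] at hsyn
  obtain ⟨L, hL, hwin⟩ := hsyn
  refine ⟨Real.exp L, Real.one_lt_exp_iff.2 hL, fun a' ha' => ?_⟩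
  obtain ⟨σ, ⟨hσ1, hσ2⟩, hσU⟩ := hwin (Real.log a')
  refine ⟨Real.exp σ, ?_, ?_, fun t x ht1 ht2 hx => ?_⟩
  · calc a' = Real.exp (Real.log a') := (Real.exp_log ha').symm
      _ ≤ Real.exp σ := Real.exp_le_exp.2 hσ1
  · calc Real.exp σ ≤ Real.exp (Real.log a' + L) := Real.exp_le_exp.2 hσ2
      _ = Real.exp L * a' := by rw [Real.exp_add, Real.exp_log ha', mul_comm]
  · -- the point lies in the piece `T n`
    have hR0 : 0 < R := by linarith
    have hRn : R ≤ (n : ℝ) + 2 := by linarith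
    have hz : ((t, x) : ℝ × EuclideanSpace ℝ (Fin 3)) ∈ T n := by
      refine mem_slabPiece.2 ⟨⟨by linarith, ?_⟩, hx.trans hRn⟩
      have : 1 / ((n : ℝ) + 2) ≤ R⁻¹ := by
        rw [one_div]; exact inv_anti₀ hR0 hRn
      show t ≤ -(1 / ((n : ℝ) + 2))
      linarith
    have hmem : ϕ σ a ∈ U := hσU
    obtain ⟨hd1, hd2⟩ := hmem
    constructor
    · have h := (ContinuousMap.dist_apply_le_dist (f := (Φ (ϕ σ a) n).1) (g := (Φ a n).1)
        ⟨(t, x), hz⟩).trans_lt hd1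
      rw [dist_eq_norm] at h
      exact h.le
    · have h := (ContinuousMap.dist_apply_le_dist (f := (Φ (ϕ σ a) n).2) (g := (Φ a n).2)
        ⟨(t, x), hz⟩).trans_lt hd2
      rw [Real.dist_eq] at h
      exact h.le

end Summit.NavierStokesRegularity.NavierStokesRegularity.Theorems.AdaptedFrequencyConverges.BirkhoffRecurrentHull

end
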